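import Summits.ABC.IUTFork.Cor312ThetaSideExactK
import Summits.ABC.IUTFork.Cor312ProvK
import Summits.ABC.IUTFork.Cor312ProvenanceGenuine
import HarnessLib

/-!
# [IUTchIII] Cor. 3.12 at the `K`-level sharp setting — the EXACT readout of the typed Statement:
# `Statement(settingPrVolSharp (pilotDataOfK D K) … t_q t) ⟺ Dupuy–Hilado's (1.1) for the genuine input` (`I.Cor312NonarchOf`)

PROOF-ONLY file (D-0012; no definitions, no `Prop` facts) of the abc-iut cell (R2 S-chain team, seat abc-iut-s2-p7 gen 3, TARGET #2
`hΘ … (or =)` — consequence of the nonarchimedean exactness `Cor312ThetaSideExactK`). TAKES NO SIDE on [IUTchIII] Cor. 3.12.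

abc-iut-c312-7's `Real.statement_settingPrVolSharp_iff` reads the typed [IUTchIII] Cor. 3.12 `Cor312.Setting.Statement` of the sharp real setting as
`↑(−deĝ_F(P_q)) ≤ −|log(Θ)|(setting)` once the `q`-ideles realise `P_q`. At `X := pilotDataOfK D K` over `K`, for EVERY realising Θ-idele `t`,
`−|log(Θ)|(setting) = ↑I.negLogThetaNonarch` (abc-iut-s2-p7 `negLogTheta_settingPrVolSharp_pilotDataOfK_eq_negLogThetaNonarch_of_isVolumeInputOf`,
p453133, on abc-iut-s2-p6 / s2-p9) and `deĝ_K(P_q) = |log(q)| = −I.negAbsLogQ` (abc-iut-w5-d056 `Cor312Prov.absLogq_eq_ndeg_qPilot_pilotDataOfK`, abc-iut-c312-8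
`Cor312Prov.negAbsLogQ_eq_neg_absLogq_of_isVolumeInputOf`). HENCE:

* §1 **`statement_settingPrVolSharp_pilotDataOfK_iff_cor312NonarchOf`** — for every genuine input `I` of `D`, every realising Θ-idele `t` and
  realising `q`-idele `t_q`: `(settingPrVolSharp (pilotDataOfK D K) … tq t _ _).Statement ↔ I.Cor312NonarchOf` — the typed Statement at the `K`
  line IS abc-iut-S2's transcription of Dupuy–Hilado's (1.1) `−deĝ̲(P_q) ≤ ln ν̄(hull U_Θ)` (nonarchimedean; Scholze–Stix (1.4) without the
  archimedean summand) for the genuine input — neither side asserted;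
  `GenuineK.cor312NonarchOf_of_statement`, `GenuineK.cor312Of_of_statement_noRead` — so the [C312] hypothesis `hst` of abc-iut-C-cert-2's
  `abc_of_cor312Statement_genuineK` (p445044) yields `I.Cor312NonarchOf`, hence `I.Cor312Of`, with NO `hΘ` (READ) binder at all (the READ binder
  of `GenuineK.cor312Of_of_statement` is idle); `GenuineK.statement_of_cor312NonarchOf` — and conversely;
* §2 `statement_settingPrVolSharp_pilotDataOfK_iff_datum` — at a genuine Θ-volume datum `T` (binder shape of the `K`-line certificates):
  `Statement ↔ T.Cor312NonarchOf` for every realising choice (the `K` twin of abc-iut-w4-d107's M-level `statement_settingPrVolSharpM_genuine_iff`).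

So at the `K` line the cell's adjudication object `hst` («the typed Cor. 3.12 Statement for every realising choice of pilot ideles») reads EXACTLY
«Dupuy–Hilado (1.1) for the genuine Θ-volume input of the datum» — a statement about hull volumes over the completions `K_{v̲}` at the bad
rational primes, with no setting, idele or indeterminacy left in it. [cite: Mochizuki2012, IUTchIII Cor. 3.12 p. 173–174]
[cite: Mochizuki2012, IUTchIV Thm. 1.10 p. 23; Steps (v)–(viii) p. 27–30] [cite: DupuyHilado2025, §1 (1.1), Def. 3.6.3, §4.12]
[claim: Mochizuki2012, status: disputed] for every quoted construction. HONEST FRAMING: an EQUIVALENCE between OUR two typings of one printed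
inequality at the genuine data; nothing here asserts or denies Cor. 3.12 for any initial Θ-data or takes a side on any author; typed ≠ proved.
-/

noncomputable section

open Set Function NumberField IsDedekindDomain
open scoped Pointwise

namespace Summit.ABC.IUTFork.Thm311.Real

open Cor312 Cor312Vol Cor312Prov Literature.IUT.LogThetaLattice Literature.IUT.LogVolume Literature.IUT.HodgeTheaters
  Literature.NumberTheory.NumberFields

variable {F K Fbar : Type} [Field F] [NumberField F] [Field K] [NumberField K] [Algebra F K] [Field Fbar]
  [Algebra F Fbar] [Algebra K Fbar] {E : WeierstrassCurve F} [E.IsElliptic] {l : ℕ} {Pb : BadPlacePredicates K}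
  (D : InitialThetaData F K Fbar E l Pb)
  (M : Type) [Field M] [NumberField M]
  (archPk : ∀ (j : (thetaIndex (pilotDataOfK D K)).Label) (vQ : (thetaIndex (pilotDataOfK D K)).VQ),
    Set ((logShellsDH (pilotDataOfK D K) (analyticLogv K)).Packet j vQ))
  (archSub : ∀ (j : (thetaIndex (pilotDataOfK D K)).Label) (v : (thetaIndex (pilotDataOfK D K)).V),
    Set ((logShellsDH (pilotDataOfK D K) (analyticLogv K)).Packet j ((thetaIndex (pilotDataOfK D K)).over v)))
  (Ψ : ℤ → ∀ v : (thetaIndex (pilotDataOfK D K)).V, v ∈ (thetaIndex (pilotDataOfK D K)).Vbad →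
    Set ((logShellsDH (pilotDataOfK D K) (analyticLogv K)).StarPacket v))
  (act : ℤ → ∀ v : (thetaIndex (pilotDataOfK D K)).V, v ∈ (thetaIndex (pilotDataOfK D K)).Vbad →
    (logShellsDH (pilotDataOfK D K) (analyticLogv K)).StarPacket v →
      Module.End ℚ ((logShellsDH (pilotDataOfK D K) (analyticLogv K)).StarPacket v))
  (Mmod : ℤ → ∀ j : (thetaIndex (pilotDataOfK D K)).LabelStar,
    Set ((logShellsDH (pilotDataOfK D K) (analyticLogv K)).GlobalPacket j.1))
  (region : ℤ → ∀ j : (thetaIndex (pilotDataOfK D K)).LabelStar, FinDivisor M → ∀ vQ : (thetaIndex (pilotDataOfK D K)).VQ,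
    Set ((logShellsDH (pilotDataOfK D K) (analyticLogv K)).Packet j.1 vQ))
  (n : ℤ) {HT : Type} {LogLink : HT → HT → Type} {IsFull : ∀ {s t : HT}, LogLink s t → Prop}
  (lat : LGPGaussianLogThetaLattice LogLink IsFull)
  {Frd : Type} {IsoF : Frd → Frd → Type} {Ob : Frd → Type} {realify : Frd → Frd} {Strip : Type}
  {IsoS : Strip → Strip → Type}
  {Mv : ∀ v : (thetaIndex (pilotDataOfK D K)).V, v ∈ (thetaIndex (pilotDataOfK D K)).Vbad → Type} [∀ v h, Monoid (Mv v h)]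
  (sig : GlobalLGPFrobenioidSignature (thetaIndex (pilotDataOfK D K)).lstar (thetaIndex (pilotDataOfK D K)).V
    (· ∈ (thetaIndex (pilotDataOfK D K)).Vbad) Frd IsoF Ob realify Strip IsoS Mv)
  (split : SplittingMonoids Mv) {ObΔ : Type}
  {N : ∀ v : (thetaIndex (pilotDataOfK D K)).V, v ∈ (thetaIndex (pilotDataOfK D K)).Vbad → Type} [∀ v h, Monoid (N v h)]
  (qData : QPilotData ObΔ N)
  (tq : ∀ (pp : Nat.Primes) (x : (thetaIndex (pilotDataOfK D K)).Fibre (.inr pp)),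
    haveI : Fact (pp : ℕ).Prime := ⟨pp.2⟩; kOf (pilotDataOfK D K) pp.1 x)
  (t : ∀ (pp : Nat.Primes) (_ : Fin (pilotDataOfK D K).lstar) (x : (thetaIndex (pilotDataOfK D K)).Fibre (.inr pp)),
    haveI : Fact (pp : ℕ).Prime := ⟨pp.2⟩; kOf (pilotDataOfK D K) pp.1 x)
  (htq0 : ∀ pp x, tq pp x ≠ 0)
  (htq1 : ∀ (pp : Nat.Primes) (x : (thetaIndex (pilotDataOfK D K)).Fibre (.inr pp)),
    haveI : Fact (pp : ℕ).Prime := ⟨pp.2⟩; placeOf (pilotDataOfK D K) pp.1 x ∉ (pilotDataOfK D K).S → ‖tq pp x‖ = 1)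

/-! ## §1. The typed Statement at the `K` line ⟺ Dupuy–Hilado's (1.1) for the genuine input -/

/-- **EXACT READOUT of the typed [IUTchIII] Cor. 3.12 Statement at the `K`-level sharp setting:
`(settingPrVolSharp (pilotDataOfK D K) … tq t _ _).Statement ↔ I.Cor312NonarchOf`** for every genuine Θ-volume input `I` of `D`, EVERY realising
Θ-idele `t` (`ht0`, `hT`) and realising `q`-idele `tq` (`htq`): abc-iut-c312-7's `statement_settingPrVolSharp_iff` (`Statement ↔ ↑(−deĝ_K(P_q)) ≤ −|log(Θ)|`),
the nonarchimedean exactness `−|log(Θ)| = ↑I.negLogThetaNonarch` (p453133) and the `q`-numbers `deĝ_K(P_q) = |log(q)| = −I.negAbsLogQ`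
(`absLogq_eq_ndeg_qPilot_pilotDataOfK`, `negAbsLogQ_eq_neg_absLogq_of_isVolumeInputOf`). Both sides are CLAIM forms; neither is asserted.
[cite: Mochizuki2012, IUTchIII Cor. 3.12 p. 173–174] [cite: Mochizuki2012, IUTchIV Thm. 1.10 p. 23; Steps (v)–(viii) p. 27–30]
[cite: DupuyHilado2025, §1 (1.1), Def. 3.6.3] -/
theorem statement_settingPrVolSharp_pilotDataOfK_iff_cor312NonarchOf (ht0 : ∀ pp i x, t pp i x ≠ 0)
    (hT : ∀ (pp : Nat.Primes) (i : Fin (pilotDataOfK D K).lstar) (x : (thetaIndex (pilotDataOfK D K)).Fibre (.inr pp)),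
      haveI : Fact (pp : ℕ).Prime := ⟨pp.2⟩
      Real.log ‖t pp i x‖ = -((pilotDataOfK D K).thetaPilot i (placeOf (pilotDataOfK D K) pp.1 x)) *
        logNorm K (placeOf (pilotDataOfK D K) pp.1 x) / localDegree K (placeOf (pilotDataOfK D K) pp.1 x))
    (htq : ∀ (pp : Nat.Primes) (x : (thetaIndex (pilotDataOfK D K)).Fibre (.inr pp)),
      haveI : Fact (pp : ℕ).Prime := ⟨pp.2⟩
      Real.log ‖tq pp x‖ = -((pilotDataOfK D K).qPilot (placeOf (pilotDataOfK D K) pp.1 x)) *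
        logNorm K (placeOf (pilotDataOfK D K) pp.1 x) / localDegree K (placeOf (pilotDataOfK D K) pp.1 x))
    {I : ThetaVolumeInput (fieldOfModuli E) K} (hI : ThetaData.IsVolumeInputOf D I) :
    (settingPrVolSharp (pilotDataOfK D K) (logvAnalytic_analyticLogv (F := K)) M archPk archSub Ψ act Mmod region n lat sig split
        qData tq t htq0 htq1).Statement ↔ I.Cor312NonarchOf := by
  have ht1 : ∀ (pp : Nat.Primes) (i : Fin (pilotDataOfK D K).lstar) (x : (thetaIndex (pilotDataOfK D K)).Fibre (.inr pp)),
      haveI : Fact (pp : ℕ).Prime := ⟨pp.2⟩; placeOf (pilotDataOfK D K) pp.1 x ∉ (pilotDataOfK D K).S → ‖t pp i x‖ = 1 :=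
    fun pp i x hx => norm_eq_one_of_realising_of_not_mem D t ht0 hT pp i x hx
  rw [statement_settingPrVolSharp_iff (pilotDataOfK D K) (logvAnalytic_analyticLogv (F := K)) M archPk archSub Ψ act Mmod region n lat sig
      split qData t tq ht0 ht1 htq0 htq1 htq,
    negLogTheta_settingPrVolSharp_pilotDataOfK_eq_negLogThetaNonarch_of_isVolumeInputOf D M archPk archSub Ψ act Mmod region n lat sig split
      qData tq t htq0 htq1 ht0 hT hI,
    WithTop.coe_le_coe, ThetaVolumeInput.Cor312NonarchOf, negAbsLogQ_eq_neg_absLogq_of_isVolumeInputOf D hI,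
    absLogq_eq_ndeg_qPilot_pilotDataOfK D K]

/-- **`hst ⟹ I.Cor312NonarchOf`, NO READ BINDER**: the typed Statement of the `K`-level sharp setting at ANY realising Θ- and `q`-ideles yields
Dupuy–Hilado's (1.1) for the genuine input (which is STRONGER than `I.Cor312Of` by the archimedean summand). Compare abc-iut-C-cert-2's
`GenuineK.cor312Of_of_statement` (p445044 §1: needs the READ binder `hΘ` and concludes only `I.Cor312Of`).
[cite: Mochizuki2012, IUTchIII Cor. 3.12 p. 173–174] [cite: DupuyHilado2025, §1 (1.1)] -/
theorem GenuineK.cor312NonarchOf_of_statement (ht0 : ∀ pp i x, t pp i x ≠ 0)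
    (hT : ∀ (pp : Nat.Primes) (i : Fin (pilotDataOfK D K).lstar) (x : (thetaIndex (pilotDataOfK D K)).Fibre (.inr pp)),
      haveI : Fact (pp : ℕ).Prime := ⟨pp.2⟩
      Real.log ‖t pp i x‖ = -((pilotDataOfK D K).thetaPilot i (placeOf (pilotDataOfK D K) pp.1 x)) *
        logNorm K (placeOf (pilotDataOfK D K) pp.1 x) / localDegree K (placeOf (pilotDataOfK D K) pp.1 x))
    (htq : ∀ (pp : Nat.Primes) (x : (thetaIndex (pilotDataOfK D K)).Fibre (.inr pp)),
      haveI : Fact (pp : ℕ).Prime := ⟨pp.2⟩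
      Real.log ‖tq pp x‖ = -((pilotDataOfK D K).qPilot (placeOf (pilotDataOfK D K) pp.1 x)) *
        logNorm K (placeOf (pilotDataOfK D K) pp.1 x) / localDegree K (placeOf (pilotDataOfK D K) pp.1 x))
    {I : ThetaVolumeInput (fieldOfModuli E) K} (hI : ThetaData.IsVolumeInputOf D I)
    (hst : (settingPrVolSharp (pilotDataOfK D K) (logvAnalytic_analyticLogv (F := K)) M archPk archSub Ψ act Mmod region n lat sig split
        qData tq t htq0 htq1).Statement) :
    I.Cor312NonarchOf :=
  (statement_settingPrVolSharp_pilotDataOfK_iff_cor312NonarchOf D M archPk archSub Ψ act Mmod region n lat sig split qData tq t htq0 htq1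
    ht0 hT htq hI).mp hst

/-- **`hst ⟹ I.Cor312Of` WITHOUT the READ binder** (abc-iut-C-cert-2's `GenuineK.cor312Of_of_statement` with `hΘ` DROPPED: nonarchimedean
exactness makes the one-sided identification an identity, and the archimedean summand is positive, abc-iut-S2 `cor312Of_of_cor312NonarchOf`).
[cite: Mochizuki2012, IUTchIII Cor. 3.12 p. 173–174] [cite: Mochizuki2012, IUTchIV Thm. 1.10 Step (vii) p. 30] -/
theorem GenuineK.cor312Of_of_statement_noRead (ht0 : ∀ pp i x, t pp i x ≠ 0)
    (hT : ∀ (pp : Nat.Primes) (i : Fin (pilotDataOfK D K).lstar) (x : (thetaIndex (pilotDataOfK D K)).Fibre (.inr pp)),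
      haveI : Fact (pp : ℕ).Prime := ⟨pp.2⟩
      Real.log ‖t pp i x‖ = -((pilotDataOfK D K).thetaPilot i (placeOf (pilotDataOfK D K) pp.1 x)) *
        logNorm K (placeOf (pilotDataOfK D K) pp.1 x) / localDegree K (placeOf (pilotDataOfK D K) pp.1 x))
    (htq : ∀ (pp : Nat.Primes) (x : (thetaIndex (pilotDataOfK D K)).Fibre (.inr pp)),
      haveI : Fact (pp : ℕ).Prime := ⟨pp.2⟩
      Real.log ‖tq pp x‖ = -((pilotDataOfK D K).qPilot (placeOf (pilotDataOfK D K) pp.1 x)) *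
        logNorm K (placeOf (pilotDataOfK D K) pp.1 x) / localDegree K (placeOf (pilotDataOfK D K) pp.1 x))
    {I : ThetaVolumeInput (fieldOfModuli E) K} (hI : ThetaData.IsVolumeInputOf D I)
    (hst : (settingPrVolSharp (pilotDataOfK D K) (logvAnalytic_analyticLogv (F := K)) M archPk archSub Ψ act Mmod region n lat sig split
        qData tq t htq0 htq1).Statement) :
    I.Cor312Of :=
  I.cor312Of_of_cor312NonarchOf (GenuineK.cor312NonarchOf_of_statement D M archPk archSub Ψ act Mmod region n lat sig split qData tq t htq0
    htq1 ht0 hT htq hI hst)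

/-- **Conversely, Dupuy–Hilado's (1.1) for the genuine input ⟹ the typed Statement of the `K`-level sharp setting** at every realising choice of
Θ- and `q`-ideles: at the `K` line the typed [IUTchIII] Cor. 3.12 Statement carries NO content beyond (1.1) — «hst» and «(1.1) at the datum» are the
same proposition. [cite: Mochizuki2012, IUTchIII Cor. 3.12 p. 173–174] [cite: DupuyHilado2025, §1 (1.1)] -/
theorem GenuineK.statement_of_cor312NonarchOf (ht0 : ∀ pp i x, t pp i x ≠ 0)
    (hT : ∀ (pp : Nat.Primes) (i : Fin (pilotDataOfK D K).lstar) (x : (thetaIndex (pilotDataOfK D K)).Fibre (.inr pp)),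
      haveI : Fact (pp : ℕ).Prime := ⟨pp.2⟩
      Real.log ‖t pp i x‖ = -((pilotDataOfK D K).thetaPilot i (placeOf (pilotDataOfK D K) pp.1 x)) *
        logNorm K (placeOf (pilotDataOfK D K) pp.1 x) / localDegree K (placeOf (pilotDataOfK D K) pp.1 x))
    (htq : ∀ (pp : Nat.Primes) (x : (thetaIndex (pilotDataOfK D K)).Fibre (.inr pp)),
      haveI : Fact (pp : ℕ).Prime := ⟨pp.2⟩
      Real.log ‖tq pp x‖ = -((pilotDataOfK D K).qPilot (placeOf (pilotDataOfK D K) pp.1 x)) *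
        logNorm K (placeOf (pilotDataOfK D K) pp.1 x) / localDegree K (placeOf (pilotDataOfK D K) pp.1 x))
    {I : ThetaVolumeInput (fieldOfModuli E) K} (hI : ThetaData.IsVolumeInputOf D I) (h : I.Cor312NonarchOf) :
    (settingPrVolSharp (pilotDataOfK D K) (logvAnalytic_analyticLogv (F := K)) M archPk archSub Ψ act Mmod region n lat sig split
        qData tq t htq0 htq1).Statement :=
  (statement_settingPrVolSharp_pilotDataOfK_iff_cor312NonarchOf D M archPk archSub Ψ act Mmod region n lat sig split qData tq t htq0 htq1
    ht0 hT htq hI).mpr h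

/-! ## §2. At a genuine Θ-volume DATUM (the binder shape of the `K`-line certificates) -/

/-- **At a datum `T : Cor22.ThetaVolumeDatumAt P l`**: for every context of abc-iut-c312-7's sharp setting over `T.K` at the pilot datum
`pilotDataOfK T.D T.K` and EVERY realising choice of Θ-ideles `t` and `q`-ideles `tq`, `Statement(setting) ↔ T.Cor312NonarchOf` — the [C312]
hypothesis `hst` of the `K` downstream certificates reads, per datum, EXACTLY «Dupuy–Hilado (1.1) for the datum's genuine input». The `K` twin
of abc-iut-w4-d107's M-level `statement_settingPrVolSharpM_genuine_iff` (p448023).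
[cite: Mochizuki2012, IUTchIII Cor. 3.12 p. 173–174] [cite: DupuyHilado2025, §1 (1.1)] -/
theorem statement_settingPrVolSharp_pilotDataOfK_iff_datum
    {P : Literature.NumberTheory.DiophantineGeometry.GenEll.NFPoint} {l : ℕ} (T : Cor22.ThetaVolumeDatumAt P l) :
    letI := T.instFieldF; letI := T.instNumberFieldF; letI := T.instAlgebraF; letI := T.instFieldK;
    letI := T.instNumberFieldK; letI := T.instAlgebraK; letI := T.instFieldFbar; letI := T.instAlgebraFbar;
    letI := T.instAlgebraKFbar; letI := T.instIsElliptic;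
    ∀ (M : Type) [Field M] [NumberField M]
      (archPk : ∀ (j : (thetaIndex (pilotDataOfK T.D T.K)).Label) (vQ : (thetaIndex (pilotDataOfK T.D T.K)).VQ),
        Set ((logShellsDH (pilotDataOfK T.D T.K) (analyticLogv T.K)).Packet j vQ))
      (archSub : ∀ (j : (thetaIndex (pilotDataOfK T.D T.K)).Label) (v : (thetaIndex (pilotDataOfK T.D T.K)).V),
        Set ((logShellsDH (pilotDataOfK T.D T.K) (analyticLogv T.K)).Packet j ((thetaIndex (pilotDataOfK T.D T.K)).over v)))
      (Ψ : ℤ → ∀ v : (thetaIndex (pilotDataOfK T.D T.K)).V, v ∈ (thetaIndex (pilotDataOfK T.D T.K)).Vbad →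
        Set ((logShellsDH (pilotDataOfK T.D T.K) (analyticLogv T.K)).StarPacket v))
      (act : ℤ → ∀ v : (thetaIndex (pilotDataOfK T.D T.K)).V, v ∈ (thetaIndex (pilotDataOfK T.D T.K)).Vbad →
        (logShellsDH (pilotDataOfK T.D T.K) (analyticLogv T.K)).StarPacket v →
          Module.End ℚ ((logShellsDH (pilotDataOfK T.D T.K) (analyticLogv T.K)).StarPacket v))
      (Mmod : ℤ → ∀ j : (thetaIndex (pilotDataOfK T.D T.K)).LabelStar,
        Set ((logShellsDH (pilotDataOfK T.D T.K) (analyticLogv T.K)).GlobalPacket j.1))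
      (region : ℤ → ∀ j : (thetaIndex (pilotDataOfK T.D T.K)).LabelStar, FinDivisor M →
        ∀ vQ : (thetaIndex (pilotDataOfK T.D T.K)).VQ, Set ((logShellsDH (pilotDataOfK T.D T.K) (analyticLogv T.K)).Packet j.1 vQ))
      (n : ℤ) {HT : Type} {LogLink : HT → HT → Type} {IsFull : ∀ {s t : HT}, LogLink s t → Prop}
      (lat : LGPGaussianLogThetaLattice LogLink IsFull)
      {Frd : Type} {IsoF : Frd → Frd → Type} {Ob : Frd → Type} {realify : Frd → Frd} {Strip : Type}
      {IsoS : Strip → Strip → Type}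
      {Mv : ∀ v : (thetaIndex (pilotDataOfK T.D T.K)).V, v ∈ (thetaIndex (pilotDataOfK T.D T.K)).Vbad → Type}
      [∀ v h, Monoid (Mv v h)]
      (sig : GlobalLGPFrobenioidSignature (thetaIndex (pilotDataOfK T.D T.K)).lstar (thetaIndex (pilotDataOfK T.D T.K)).V
        (· ∈ (thetaIndex (pilotDataOfK T.D T.K)).Vbad) Frd IsoF Ob realify Strip IsoS Mv)
      (split : SplittingMonoids Mv) {ObΔ : Type}
      {N : ∀ v : (thetaIndex (pilotDataOfK T.D T.K)).V, v ∈ (thetaIndex (pilotDataOfK T.D T.K)).Vbad → Type} [∀ v h, Monoid (N v h)]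
      (qData : QPilotData ObΔ N)
      (tq : ∀ (pp : Nat.Primes) (x : (thetaIndex (pilotDataOfK T.D T.K)).Fibre (.inr pp)),
        haveI : Fact (pp : ℕ).Prime := ⟨pp.2⟩; kOf (pilotDataOfK T.D T.K) pp.1 x)
      (t : ∀ (pp : Nat.Primes) (_ : Fin (pilotDataOfK T.D T.K).lstar) (x : (thetaIndex (pilotDataOfK T.D T.K)).Fibre (.inr pp)),
        haveI : Fact (pp : ℕ).Prime := ⟨pp.2⟩; kOf (pilotDataOfK T.D T.K) pp.1 x)
      (htq0 : ∀ pp x, tq pp x ≠ 0)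
      (htq1 : ∀ (pp : Nat.Primes) (x : (thetaIndex (pilotDataOfK T.D T.K)).Fibre (.inr pp)),
        haveI : Fact (pp : ℕ).Prime := ⟨pp.2⟩; placeOf (pilotDataOfK T.D T.K) pp.1 x ∉ (pilotDataOfK T.D T.K).S → ‖tq pp x‖ = 1),
      (∀ pp i x, t pp i x ≠ 0) →
      (∀ (pp : Nat.Primes) (i : Fin (pilotDataOfK T.D T.K).lstar) (x : (thetaIndex (pilotDataOfK T.D T.K)).Fibre (.inr pp)),
        haveI : Fact (pp : ℕ).Prime := ⟨pp.2⟩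
        Real.log ‖t pp i x‖ = -((pilotDataOfK T.D T.K).thetaPilot i (placeOf (pilotDataOfK T.D T.K) pp.1 x)) *
          logNorm T.K (placeOf (pilotDataOfK T.D T.K) pp.1 x) / localDegree T.K (placeOf (pilotDataOfK T.D T.K) pp.1 x)) →
      (∀ (pp : Nat.Primes) (x : (thetaIndex (pilotDataOfK T.D T.K)).Fibre (.inr pp)),
        haveI : Fact (pp : ℕ).Prime := ⟨pp.2⟩
        Real.log ‖tq pp x‖ = -((pilotDataOfK T.D T.K).qPilot (placeOf (pilotDataOfK T.D T.K) pp.1 x)) *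
          logNorm T.K (placeOf (pilotDataOfK T.D T.K) pp.1 x) / localDegree T.K (placeOf (pilotDataOfK T.D T.K) pp.1 x)) →
      ((settingPrVolSharp (pilotDataOfK T.D T.K) (logvAnalytic_analyticLogv (F := T.K)) M archPk archSub Ψ act Mmod region n lat
          sig split qData tq t htq0 htq1).Statement ↔ T.Cor312NonarchOf) := by
  intro M _ _ archPk archSub Ψ act Mmod region n HT LogLink IsFull lat Frd IsoF Ob realify Strip IsoS Mv _ sig split ObΔ N _ qData
    tq t htq0 htq1 ht0 hT htq
  letI := T.instFieldF; letI := T.instNumberFieldF; letI := T.instAlgebraF; letI := T.instFieldK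
  letI := T.instNumberFieldK; letI := T.instAlgebraK; letI := T.instFieldFbar; letI := T.instAlgebraFbar
  letI := T.instAlgebraKFbar; letI := T.instIsElliptic
  exact statement_settingPrVolSharp_pilotDataOfK_iff_cor312NonarchOf T.D M archPk archSub Ψ act Mmod region n lat sig split qData tq t
    htq0 htq1 ht0 hT htq T.isVolumeInputOf

end Summit.ABC.IUTFork.Thm311.Real

end
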